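import Literature.NumberTheory.K2Lit.DoublingZetaIntegral
import Literature.NumberTheory.Automorphic.Liu2021.CurveThetaNonOrthogonal
import Literature.NumberTheory.Automorphic.AdelicGLnGlue                              -- ★ `adelicHeightGL` (#16a ∕ #16b, ED. 5)
import Summits.HodgeConjecture.HodgeConjecture.Theorems.K2LiuQuotMatrixCoeffBound    -- ★ p854883 (K2Liu-p07): #14bR PAID, tied ED. 5
import Summits.HodgeConjecture.HodgeConjecture.Theorems.K2LiuDoublingHeightDecayPointwise  -- ★ p855227 (K2Liu-p04): #16a PAID, tied ED. 7
import Summits.HodgeConjecture.HodgeConjecture.Theorems.K2LiuAdelicNormIntegrable          -- ★ p855222 (K2Liu-p03 g2 + p07 p06 p02): #16b PAID, tied ED. 7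
import Summits.HodgeConjecture.HodgeConjecture.Theorems.K2LiuDoublingUnfold                -- ★ p855244 (K2Liu-p01): #13 PAID, tied ED. 8
import Summits.HodgeConjecture.HodgeConjecture.Theorems.K2LiuDoublingHeightDecay           -- ★ p855285 (K2Liu-p04): #16 PAID, tied ED. 8
import Summits.HodgeConjecture.HodgeConjecture.Theorems.K2LiuDoublingSectionIntegrable     -- ★ p855286 (K2Liu-p04): #14a PAID, tied ED. 8

/-!
# K2_Liu_CurveThetaSigs — unit U5 «DOUBLING ZETA INTEGRAL: CONVERGENCE INPUTS» (tier-1 socket module for hLiu418 = stmt-HodgeConjecture-24832)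

ED. 8 (22:40Z): #13 ∕ #16 ∕ #14a TIED BY NAME to ★ p855244 ∕ ★ p855285 ∕ ★ p855286 (imports of the three `Theorems/` files; statement bytes unchanged); the module is now
SORRY-FREE — every U5 socket (#14a #14bR #13 #16 #16a #16b) is PAID and tied.
ED. 7 (22:30Z): #16a ∕ #16b TIED BY NAME to ★ p855227 ∕ ★ p855222 (imports of the two `Theorems/` files; statement bytes unchanged); live sorries 3 = {#14a :59, #13 :130, #16 :205}.

Track B ∕ build stream 29 (`Cruxes/HLiu418/Lines/K2_Liu_*`). Planner `hodgecm-mathlib-K2Liu-plan` g0,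
2026-09-03. INFO-ONLY companion to the #184♮ LINE `Cruxes/HLiu418/Lines/K2_Liu_CurveThetaNonOrthogonal.lean`
(A-plan2 (g33)); strategy-neutral (roads S-A and S-B both pass through the doubling zeta integral — organs O2∕O3 of
the LEAD's ADDENDUM v1.1). Sockets of SIG TABLE row #14 «the doubling zeta integral converges» (Liu 2021 Lem. B.10 (2),
(4) p. 102 at `a = 0`: «The integral (B.4) is absolutely convergent for Re(s) > (n+a)/2», proof «same as in [Mœg97,
Section 2.1]»), cut into its two by-name inputs over the DEFS leaves that landed tonight:
★ `Literature/NumberTheory/K2Lit/DoublingZetaIntegral.lean` (p854754: `quotMatrixCoeff`, `doublingZeta`,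
`DoublingZetaConverges`), ★ `…/DoublingEmbedding.lean` (p854744: `iotaV`, `iotaLeft`), ★ `…/SiegelEisensteinSeriesDoubled.lean`
(p854694: `IsSiegelDeltaSection`). (a) #14a the SECTION is `L¹` along `g ↦ ι(g, 1)` in a right half-plane; (b) #14b the
MATRIX COEFFICIENT of two `L²` functions on the automorphic quotient is bounded by the product of the `L²` norms
(Cauchy–Schwarz + invariance of `μ`). The glue (a)+(b) ⇒ ★ `DoublingZetaConverges` under the bridge `ιA` of #184♮ is
row #14c (next generation, once the Haar conventions on the two models of `U(V)(𝔸)` are matched by `hιA`).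
One `theorem sig_<File> : ‹statement› := by sorry` per planned file; no `def`/`instance`/`notation`.
ED. 5 (2026-09-03 ≈21:40Z, LEAD 21:26:18Z ∕ 21:27:24Z): #14bR TIED BY NAME to ★ p854883 `Theorems/K2LiuQuotMatrixCoeffBound`
(K2Liu-p07); NEW sockets #16a `sig_K2LiuDoublingHeightDecayPointwise` (organ (IV-c)) and #16b `sig_K2LiuAdelicNormIntegrable`
(organ (IV-d)) typed from K2Liu-p04's `K2/K2Liu-p04/g0/PLAN-16-DoublingHeightDecay.v1.K2Liu-p04-g0.md` §Organs ((IV-c)+(IV-d) ⇒ #16 by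
(IV-e), S); cite key `PiatetskiShapiroRallis1987` (absent from references.bib) corrected to `GelbartPiatetskishapiroRallis1987` in the
docstrings of #14a, #13, #16 (their `theorem … :=` statement blocks are byte-identical to ED. 3∕4).
ED. 6 (2026-09-03 ≈21:57Z): #16a `sig_K2LiuDoublingHeightDecayPointwise` RE-TYPED IN PLACE before any TAKE — ONE binder `[NeZero N]` inserted right after
`{N n : ℕ}` (K2Liu-ref1 BOX #9 pt 1: ED. 5 false at the junk corner `N = 0`, `adelicHeightGL 0 = 0`; LEAD RULING 21:51:22Z (A)); #16 :202 and #16b :266 are TRUE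
at `N = 0` and stay FROZEN (#16b TAKEN by K2Liu-p03 g2); the (IV-e) assembly #16a + #16b ⇒ #16 cases on `N = 0` inside K2Liu-p04's proof.
HONEST LABEL: HC_CM is proved only modulo the 7 printed citations (2 remaining named inputs:
hLiu418 = stmt-HodgeConjecture-24832, h413 = stmt-HodgeConjecture-24833) until rung 0 closes.
-/

open scoped Matrix ENNReal
open NumberField IsDedekindDomain MeasureTheory

namespace Summit.HodgeConjecture.HodgeConjecture.Cruxes.HLiu418.K2LiuCurveThetaSigsU5DoublingZeta

open Literature.NumberTheory.Automorphic Literature.NumberTheory.GaloisRepresentations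
open Literature.NumberTheory.GelbartRogawski1991 Literature.NumberTheory.GelbartRogawski1991.GRConstruction
open Literature.NumberTheory.K2Lit.SiegelDoubled
open Literature.NumberTheory.Automorphic.UnitaryGroup (adelicGroupData adelicVal)
open Literature.AlgebraicGeometry.ShimuraVarieties (hermForm)

/-- socket #14a (U5) — **a continuous Siegel section is `L¹` along the doubling embedding in a right half-plane**:
for the doubled group `H(𝔸) = U(V_W ⊕ −V_W)(𝔸)` of a hermitian space `V` of rank `N` and a hermitian LINE `W` (`M = 1`,
so `V_W = V ⊗ W ≅ V` rescaled, `n = N`), there is `σ₀` (depending on the datum and on `χ`) such that for `Re s > σ₀`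
every CONTINUOUS section `f ∈ I_Δ(s, χ)` (★ `IsSiegelDeltaSection χ s f`) satisfies
`∫_{U(V)(𝔸)} |f(ι(g, 1))| dν(g) < ∞` for any Haar measure `ν` on `U(V)(𝔸)`. Mechanism (PSR ∕ Mœglin): Iwasawa
`H(𝔸) = P_Δ(𝔸)·K` with `K` compact bounds `|f(h)| ≤ ‖f|_K‖_∞ · |χ(det_Δ p)| · |det_Δ p|^{Re s + n/2}` (`h = p k`), and
`g ↦ |det_Δ|` of the `P_Δ`-part of `ι(g, 1)` decays like a negative power of `‖g‖`, integrable over `U(V)(𝔸)` once the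
exponent is large. Stated with `∃ σ₀` (the weakest form the assembly needs: convergence in SOME half-plane, then
meromorphic continuation; Liu asserts `σ₀ = n/2` for standard sections and unitary `χ`).
Why it might fail: only if the ★ topology on `UnitaryGroup.adelic` ∕ `HA` is not the locally compact group topology
(then `IsHaarMeasure ν` is unsatisfiable and the socket is VACUOUS — referee: check ★ `continuous_iotaV` and the
restricted-product topology lemmas), or if ★ `HeckeCharacter` admits characters with no polynomial growth bound on ideles.
[cite: Liu2021, Lem. B.10 (2) p. 102] [cite: GelbartPiatetskishapiroRallis1987, Part A §1] [cite: HarrisKudlaSweet1996, §1 (WANT acq-04821)]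
audit: paper:liu2021-fourier-jacobi-cycles-arithmetic-relative-trace-formula p0102.txt:L8 «(2) The integral (B.4) is absolutely convergent for Re(s) > n+a / 2 .» -/
theorem sig_K2LiuDoublingSectionIntegrable :
    ∀ (L : Type) [Field L] [NumberField L] [IsCMField L] {N n : ℕ} (e : Fin N × Fin 1 ≃ Fin n)
      (dV : Fin N → L) (hdV : ∀ i, IsCMField.complexConj L (dV i) = dV i) (_hdV0 : ∀ i, dV i ≠ 0)
      (dW : Fin 1 → L) (hdW : ∀ i, IsCMField.complexConj L (dW i) = dW i) (_hdW0 : ∀ i, dW i ≠ 0)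
      (χ : HeckeCharacter L),
      ∃ σ₀ : ℝ, ∀ (s : ℂ), σ₀ < s.re →
        ∀ (f : HA L e dV hdV dW hdW → ℂ), IsSiegelDeltaSection L e dV hdV dW hdW χ s f → Continuous f →
          ∀ [MeasurableSpace (UnitaryGroup.adelic (Fp L) L (IsCMField.complexConj L) N (Matrix.diagonal dV))]
            [BorelSpace (UnitaryGroup.adelic (Fp L) L (IsCMField.complexConj L) N (Matrix.diagonal dV))]
            (ν : Measure (UnitaryGroup.adelic (Fp L) L (IsCMField.complexConj L) N (Matrix.diagonal dV)))
            [ν.IsHaarMeasure],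
            Integrable (fun g => f (iotaLeft L e dV hdV dW hdW g)) ν :=
  -- ED. 8: TIED BY NAME to ★ p855286 `Theorems/K2LiuDoublingSectionIntegrable.lean` (K2Liu-p04 (g0)); statement block unchanged.
  Summit.HodgeConjecture.HodgeConjecture.Cruxes.HLiu418.K2LiuDoublingSectionIntegrable.doublingSectionIntegrable

-- socket #14b `sig_K2LiuQuotMatrixCoeffBound` (U5 ED. 1–3 :74∕:75) — EXCISED in ED. 4 (RULING R8 (b)): REFUTED AS TYPED in the
-- non-measurable corner by K2Liu-p07 (g0) — kernel-checked `NEG_K2LiuQuotMatrixCoeffBoundFalseOfInnerNull.lean` 32b1b2010b4ea0c8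
-- (`not_quotMatrixCoeffBound_noBinder_of_innerNull`: any (𝒢, μ) whose quotient carries a set S with S and Sᶜ inner-null — a Bernstein
-- set — refutes the un-bindered bound with φ₁ = 𝟙_S + 1, φ₂ = 𝟙_{Sᶜ} + 1, g = 1: Mathlib `eLpNorm`∕`lintegral` are LOWER integrals and
-- Hölder fails on non-measurable factors with measurable product; memo `K2/K2Liu-p07/g0/RED-14b-QuotMatrixCoeffBound.md`). The typist's
-- corner pass 21:22:52Z («hypothesis-free in ℝ≥0∞ survives all corners») was WRONG on exactly this corner. Replaced by #14bR below
-- (p07's repaired bytes VERBATIM, cand 5a6ba9568308c8d7), already proved at home by p07 (`…K2LiuQuotMatrixCoeffBound.quotMatrixCoeffBound`).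

/-- socket #14bR (U5; repairs #14b, RULING R8; ★ PAID p854883 (K2Liu-p07) `Theorems/K2LiuQuotMatrixCoeffBound.quotMatrixCoeffBound`,
statement BYTE-IDENTICAL, TIED BY NAME in ED. 5) — **matrix coefficients of a.e.-strongly measurable `L²` functions on the automorphic
quotient are bounded by the `L²` norms**: for a `G(𝔸)`-invariant measure `μ` on `[G] = G(𝔸) ⧸ A_G G(K)` (★ `IsAutomorphicMeasure`,
the binder of #184♮), two A.E.-STRONGLY MEASURABLE functions `φ₁ φ₂ : [G] → ℂ` and every `g`, `‖⟨π(g)φ₁, φ₂⟩‖ ≤ ‖φ₁‖₂ · ‖φ₂‖₂`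
(★ `quotMatrixCoeff`, tree convention `(π(g)φ)(x) = φ(g⁻¹ • x)`): Cauchy–Schwarz (Mathlib `ENNReal.lintegral_mul_le_Lp_mul_Lq`) plus
`∫ |φ₁(g⁻¹ • x)|² dμ = ∫ |φ₁|² dμ` (invariance of `μ`; `x ↦ g⁻¹ • x` measurable from ★ `ContinuousConstSMul` + Borel). Stated in
`ℝ≥0∞` with `‖·‖ₑ`, so NO integrability hypothesis; the measurability binders are NECESSARY: Mathlib's `eLpNorm`∕`lintegral` are LOWER
integrals, and for non-measurable `φ₁ = 𝟙_S + ε`, `φ₂ = 𝟙_{Sᶜ} + ε` (`S`, `Sᶜ` of inner measure `0`) the product `φ₁ conj φ₂ ≡ ε + ε²`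
is measurable with `‖⟨φ₁, φ₂⟩‖ₑ = (ε + ε²)μ[G] > ε² μ[G] = ‖φ₁‖₂‖φ₂‖₂` — the un-binder'd #14b is false (memo of K2Liu-p07 (g0)).
Consumers (#13, #14c) have continuous, hence strongly measurable, `φᵢ` (Mathlib `Continuous.aestronglyMeasurable`).
The prover's ★ file also proves the sharper ONE-SIDED forms (`quotMatrixCoeffBound_of_left ∕ _of_right`: only one `φᵢ` measurable).
[cite: Liu2021, §B.3 (B.7) p. 101] [cite: BorelJacquet1979, §4.6]
audit: paper:liu2021-fourier-jacobi-cycles-arithmetic-relative-trace-formula p0101.txt:L47 «(B.4) … fa,s (ι(g −1 g , 1))φ(g)dg» -/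
theorem sig_K2LiuQuotMatrixCoeffBoundR :
    ∀ {K : Type} [Field K] [NumberField K] (𝒢 : AdelicGroupData.{0} K)
      (μ : Measure 𝒢.automorphicQuotient) [𝒢.IsAutomorphicMeasure μ]
      (φ₁ φ₂ : 𝒢.automorphicQuotient → ℂ) (g : 𝒢.Adelic),
      AEStronglyMeasurable φ₁ μ → AEStronglyMeasurable φ₂ μ →
      ‖quotMatrixCoeff 𝒢 μ φ₁ φ₂ g‖ₑ ≤ eLpNorm φ₁ 2 μ * eLpNorm φ₂ 2 μ :=
  Summit.HodgeConjecture.HodgeConjecture.Cruxes.HLiu418.K2LiuQuotMatrixCoeffBound.quotMatrixCoeffBound -- ★ PAID p854883 (K2Liu-p07), tied ED. 5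


set_option maxHeartbeats 2000000 in -- #184♮'s adelic unitary datum + the doubled group's telescope
/-- socket U5a = #13 (U5 ED. 2, RE-TYPED ED. 3 on K2Liu-p01's REPORT-FIRST 21:19:45Z + LEAD ruling 21:19:59Z: binders `_hdV0 _hdW0`
(non-degenerate doubled form — in the corner `dW 0 = 0`, `HA = GL_{2n}` has extra `P_Δ`-orbits and the identity is FALSE for non-cuspidal `φ`) and
`_hanis` (V anisotropic — the single-orbit step; `[CompactSpace …]` kept, derivable from `_hanis` by ★ `compactSpace_cmDatum_automorphicQuotient`); size XL (p01: ≈ 900–1 400 l. over 7 helper files H1–H7); deps ★ `K2Lit/DoublingZetaIntegral` (`doublingPairing`, `toQuotFun₂`, `eisensteinPullback`,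
`doublingZeta`, `DoublingZetaConverges`, `quotMatrixCoeff`), ★ `K2Lit/DoublingEmbedding` (`iotaV`, `iotaLeft`, `isSiegelDelta_iotaV_diag`,
`iotaV_eq_mul`), ★ D2-bis (`IsSiegelDeltaSection`, `siegelDeltaCharacter_mul`, `SiegelDeltaQuot`), sockets #12₀ `DoublingLagrangianIsGraph` +
#12₁ `HermitianWittTransitive` (★ Theorems: the orbit structure of `P_Δ(L⁺)\H(L⁺)/ι(G×G)(L⁺)`), #10a (the twist is a class function on `[G]`),
Mathlib `MeasureTheory.IsFundamentalDomain` ∕ quotient-measure unfolding (pattern: ★ `H413E2OrbitUnfold`); junction J-natural: the SAME bridge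
`ιA`∕`hιA` binders as #184♮ `Liu2021.curveTheta_nonOrthogonal₂` with `2 ↦ N`; OWNER K2Liu; organ O2) —
**THE DOUBLING UNFOLDING at `a = 0` in the ♮ regime (single orbit).** For the adelic unitary datum `𝒢 = adelicGroupData L⁺ L c N H` of
#184♮ (compact automorphic quotient `[G]`, i.e. `V` anisotropic: Liu's double coset (B.5) has ONE element, the stabiliser of the identity coset
is the diagonal, and NO cuspidality is needed), the bridge `ιA : 𝒢.Adelic →* U(diag dV)(𝔸)` (`hιA`: conjugation by the rational `g` with
`ᵗḡ (tH) g = diag dV`), a `G(𝔸)`-invariant probability-type measure `μ` on `[G]` (★ `IsAutomorphicMeasure`): there is a Haar measure `ν` on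
`G(𝔸)` (the one Weil-compatible with `μ` and the counting measure on `G(L⁺)`) such that for every character `χ`, every `s`, every CONTINUOUS
Siegel section `f ∈ I_Δ(s, χ)` whose `‖f‖`-Eisenstein series converges termwise and whose pulled-back majorant is integrable against
`‖φ₁‖ ⊗ ‖φ₂‖` on `[G] × [G]` (= the absolute-convergence regime `Re s > n/2` of socket #9), and all continuous `φ₁ φ₂ : [G] → ℂ`:
`∫_{[G]×[G]} E(ι(ιA y₁, ιA y₂); f) φ₁ φ̄₂ = ∫_{G(𝔸)} f(ι(ιA t, 1)) ⟨π(t)φ₁, φ₂^χ⟩ dν(t)` with the right side absolutely convergent, where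
`φ₂^χ(x) = conj(χ_s(ι(a_x, a_x))) · φ₂(x)`, `a_x = ιA((out x)⁻¹)`, `χ_s = ` ★ `siegelDeltaCharacter χ s` (the value `χ(det_Δ ι(a,a))`, Liu's
«`φ(g) μ(det g)`» in B.11; a class function on `[G]` by #10a). DERIVATION in the tree's LEFT-coset dictionary (`toQuotFun`: `x = [h] ↦ Φ(h⁻¹)`;
`(π(t)φ)(x) = φ(t⁻¹ • x)` = ★ `quotMatrixCoeff`): unfold `y₁` over the single orbit `{P_Δ(L⁺) ι(ξ,1)}_{ξ ∈ G(L⁺)}`, factor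
`f(ι(y₁′, y₂′)) = χ_s(ι(y₂′, y₂′)) f(ι(y₂′⁻¹ y₁′, 1))` (★ `iotaV_eq_mul` + section law + ★ `isSiegelDelta_iotaV_diag`), substitute `y₁ = y₂ t`
(left Haar invariance), Fubini, and read `φ₁^{cl}(y₂ t) = φ₁(t⁻¹ • x₂)`.
Why it might fail: a convention slip is the only risk and is what the referee must box — (i) the twist lands on `φ₂` with a `conj`, (ii) the
argument of `f` is `ι(ιA t, 1)` with `t` (not `t⁻¹`) against `quotMatrixCoeff … t`; both were derived line by line above, and the cheapest check is
the case `N = 0`∕`f` = indicator-free constant section at a place where everything is finite (all three tokens collapse).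
[cite: Liu2021, Lem. B.11 p. 102 (a = 0)] [cite: GelbartPiatetskishapiroRallis1987, Part A §1–§2] [cite: HarrisKudlaSweet1996, §1 (1.2)–(1.5) (WANT acq-04821)]
audit: paper:liu2021-fourier-jacobi-cycles-arithmetic-relative-trace-formula p0102.txt:L37 «Lemma B.11. For a standard section fa,s ∈ J (s, μc ) and a cusp form φ ∈ Vπ , we have the identity … EPa (ι(g , g); fa,s )φ(g)μ(det g)dg = EQa (g ; fa,s,φ)» -/
theorem sig_K2LiuDoublingUnfold :
    ∀ (L : Type) [Field L] [NumberField L] [IsCMField L] {N n : ℕ} (e : Fin N × Fin 1 ≃ Fin n)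
      (H : Matrix (Fin N) (Fin N) L)
      (dV : Fin N → L) (hdV : ∀ i, IsCMField.complexConj L (dV i) = dV i)
      (dW : Fin 1 → L) (hdW : ∀ i, IsCMField.complexConj L (dW i) = dW i)
      (_hdV0 : ∀ i, dV i ≠ 0) (_hdW0 : ∀ i, dW i ≠ 0)
      (t : L) (_ht : t ≠ 0) (g : GL (Fin N) L)
      (_hg : formCongr ((IsCMField.complexConj L : L ≃ₐ[↥(maximalRealSubfield L)] L) : L →+* L) g (t • H) = Matrix.diagonal dV)
      (_hanis : ∀ x : Fin N → L, hermForm (cmConjRingHom L) H x x = 0 → x = 0)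
      (μ : Measure (adelicGroupData (↥(maximalRealSubfield L)) L (IsCMField.complexConj L) N H).automorphicQuotient)
      [(adelicGroupData (↥(maximalRealSubfield L)) L (IsCMField.complexConj L) N H).IsAutomorphicMeasure μ]
      (ιA : (adelicGroupData (↥(maximalRealSubfield L)) L (IsCMField.complexConj L) N H).Adelic →*
        ↥(UnitaryGroup.adelic (↥(maximalRealSubfield L)) L (IsCMField.complexConj L) N (Matrix.diagonal dV))),
      (∀ k, ((ιA k : ↥(UnitaryGroup.adelic (↥(maximalRealSubfield L)) L (IsCMField.complexConj L) N (Matrix.diagonal dV))) :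
            GL (Fin N) (AdeleRing (𝓞 L) L)) =
          (toAdeleGL L g)⁻¹ * adelicVal (↥(maximalRealSubfield L)) L (IsCMField.complexConj L) N H k * toAdeleGL L g) →
      ∀ [CompactSpace (adelicGroupData (↥(maximalRealSubfield L)) L (IsCMField.complexConj L) N H).automorphicQuotient]
        [MeasurableSpace (adelicGroupData (↥(maximalRealSubfield L)) L (IsCMField.complexConj L) N H).Adelic]
        [BorelSpace (adelicGroupData (↥(maximalRealSubfield L)) L (IsCMField.complexConj L) N H).Adelic],
      ∃ ν : Measure (adelicGroupData (↥(maximalRealSubfield L)) L (IsCMField.complexConj L) N H).Adelic, ν.IsHaarMeasure ∧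
        ∀ (χ : HeckeCharacter L) (s : ℂ) (f : HA L e dV hdV dW hdW → ℂ),
          IsSiegelDeltaSection L e dV hdV dW hdW χ s f → Continuous f →
          (∀ h : HA L e dV hdV dW hdW, Summable fun q : SiegelDeltaQuot L e dV hdV dW hdW =>
              ‖f (((Quotient.out q : ratH L e dV hdV dW hdW) : HA L e dV hdV dW hdW) * h)‖) →
          ∀ (φ₁ φ₂ : (adelicGroupData (↥(maximalRealSubfield L)) L (IsCMField.complexConj L) N H).automorphicQuotient → ℂ),
            Continuous φ₁ → Continuous φ₂ →
            Integrable (fun x : (adelicGroupData (↥(maximalRealSubfield L)) L (IsCMField.complexConj L) N H).automorphicQuotient ×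
                  (adelicGroupData (↥(maximalRealSubfield L)) L (IsCMField.complexConj L) N H).automorphicQuotient =>
                ‖toQuotFun₂ (adelicGroupData (↥(maximalRealSubfield L)) L (IsCMField.complexConj L) N H)
                    (eisensteinPullback L e dV hdV dW hdW
                      (adelicGroupData (↥(maximalRealSubfield L)) L (IsCMField.complexConj L) N H) ιA
                      (fun h => ((‖f h‖ : ℝ) : ℂ))) x‖ * ‖φ₁ x.1‖ * ‖φ₂ x.2‖) (μ.prod μ) →
            DoublingZetaConverges L e dV hdV dW hdW (adelicGroupData (↥(maximalRealSubfield L)) L (IsCMField.complexConj L) N H)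
                ν μ ιA f φ₁
                (fun x => starRingEnd ℂ (siegelDeltaCharacter L e dV hdV dW hdW χ s
                    (iotaV L e dV hdV dW hdW
                      (ιA ((Quotient.out (x : (adelicGroupData (↥(maximalRealSubfield L)) L (IsCMField.complexConj L) N H).Adelic ⧸
                          (adelicGroupData (↥(maximalRealSubfield L)) L (IsCMField.complexConj L) N H).quotientSubgroup)) :
                          (adelicGroupData (↥(maximalRealSubfield L)) L (IsCMField.complexConj L) N H).Adelic)⁻¹,
                       ιA ((Quotient.out (x : (adelicGroupData (↥(maximalRealSubfield L)) L (IsCMField.complexConj L) N H).Adelic ⧸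
                          (adelicGroupData (↥(maximalRealSubfield L)) L (IsCMField.complexConj L) N H).quotientSubgroup)) :
                          (adelicGroupData (↥(maximalRealSubfield L)) L (IsCMField.complexConj L) N H).Adelic)⁻¹))) * φ₂ x) ∧
              doublingPairing (adelicGroupData (↥(maximalRealSubfield L)) L (IsCMField.complexConj L) N H) μ
                  (toQuotFun₂ (adelicGroupData (↥(maximalRealSubfield L)) L (IsCMField.complexConj L) N H)
                    (eisensteinPullback L e dV hdV dW hdW
                      (adelicGroupData (↥(maximalRealSubfield L)) L (IsCMField.complexConj L) N H) ιA f)) φ₁ φ₂ =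
                doublingZeta L e dV hdV dW hdW (adelicGroupData (↥(maximalRealSubfield L)) L (IsCMField.complexConj L) N H)
                  ν μ ιA f φ₁
                  (fun x => starRingEnd ℂ (siegelDeltaCharacter L e dV hdV dW hdW χ s
                      (iotaV L e dV hdV dW hdW
                        (ιA ((Quotient.out (x : (adelicGroupData (↥(maximalRealSubfield L)) L (IsCMField.complexConj L) N H).Adelic ⧸
                            (adelicGroupData (↥(maximalRealSubfield L)) L (IsCMField.complexConj L) N H).quotientSubgroup)) :
                            (adelicGroupData (↥(maximalRealSubfield L)) L (IsCMField.complexConj L) N H).Adelic)⁻¹,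
                         ιA ((Quotient.out (x : (adelicGroupData (↥(maximalRealSubfield L)) L (IsCMField.complexConj L) N H).Adelic ⧸
                            (adelicGroupData (↥(maximalRealSubfield L)) L (IsCMField.complexConj L) N H).quotientSubgroup)) :
                            (adelicGroupData (↥(maximalRealSubfield L)) L (IsCMField.complexConj L) N H).Adelic)⁻¹))) * φ₂ x) :=
  -- ED. 8: TIED BY NAME to ★ p855244 `Theorems/K2LiuDoublingUnfold.lean` (K2Liu-p01 (g0); H1–H5 + H4a/H4b mainOrbit files); statement block unchanged.
  Summit.HodgeConjecture.HodgeConjecture.Cruxes.HLiu418.K2LiuDoublingUnfold.doublingUnfold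


/-- socket #16 (U5 ED. 3; organ (IV) «DOUBLING DECAY» of #14a; size XL; OWNER K2Liu-p04 lineage; deps ★ `K2Lit/DoublingEmbedding` (`iotaLeft`,
`continuous_iotaLeft`), ★ `GRConstruction.modDelta ∕ IsSiegelDelta`, ★ p854858 `Theorems/K2LiuDoublingSectionIntegrableReduction`
(`exists_threshold_integrable_comp_iotaLeft`: (I) ∧ (IV) ⇒ #14a — the hypothesis `hdecay` there is THIS conclusion verbatim), ★ p854827
`Theorems/K2LiuSiegelDoubledIwasawaCompact` (organ (I)); shape ruled by LEAD 21:20:27Z (∀Φ form parallel to #15b, one height Φ of record shared with p09)) —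
**DOUBLING DECAY OF A `P_Δ`-HEIGHT ALONG `g ↦ ι(g,1)`.** For non-degenerate data (`dV i ≠ 0`, `dW 0 ≠ 0`; `W` of rank 1 — the U5 frame) and EVERY
continuous height `Φ : H(𝔸) → ℝ_{>0}` of type `(P_Δ, modDelta)` (`Φ(p x) = |det_Δ p|^{1/2} Φ(x)`), there is a threshold `τ₁` such that for all `τ ≥ τ₁`
and every Haar measure `ν` on `U(V)(𝔸) = U(diag dV)(𝔸)`, `g ↦ Φ(ι(g,1))^τ` is `ν`-integrable. Classical content ([PSR87 Part A §1–§2], [Liu2021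
Lem. B.10 (2)]): locally `|Δ(ι(g_v,1))|_v ≍ ∏ max(1,|entries of g_v|)^{-1}`-type decay (the doubling embedding moves `P_Δ`-height to the matrix
height of `g`), `≤ 1` at almost all places, and `∫_{U(V)(F_v)} ‖g_v‖^{-τ} dg_v < ∞` for `τ` large with the Euler product convergent (Weil's
adelic integrability criterion [WeilBNT1967 VII §3]); the ∀Φ form is equivalent to the ∃Φ form since two heights of the same type differ by a
function on the compact `P_Δ(𝔸)\H(𝔸)` bounded above and below (p09's helper №3). DEGENERATE-CORNER PASS (LEAD 21:19:59Z): `N = 0` ⇒ `U(V)(𝔸)`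
trivial, integrable ✓ (true, harmless); `dV i = 0` ∕ `dW 0 = 0` excluded by `_hdV0 ∕ _hdW0`; `V` isotropic: the statement stays TRUE (decay is a
local-global growth estimate, no anisotropy needed) — no corner kill.
Why it might fail: only if `Φ ∘ ι(·,1)` were unbounded ABOVE on `U(V)(𝔸)` (then large `τ` hurts) — it is not: `Φ(ι(g,1)) ≤ C·Φ(1)`-type bound
place by place with `C_v = 1` almost everywhere is part of the same computation; the prover states it as the first helper.
[cite: GelbartPiatetskishapiroRallis1987, Part A §1–§2] [cite: Liu2021, Lem. B.10 (2) p. 102] [cite: WeilBNT1967, Ch. VII §3] -/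
theorem sig_K2LiuDoublingHeightDecay :
    ∀ (L : Type) [Field L] [NumberField L] [IsCMField L] {N n : ℕ} (e : Fin N × Fin 1 ≃ Fin n)
      (dV : Fin N → L) (hdV : ∀ i, IsCMField.complexConj L (dV i) = dV i) (_hdV0 : ∀ i, dV i ≠ 0)
      (dW : Fin 1 → L) (hdW : ∀ i, IsCMField.complexConj L (dW i) = dW i) (_hdW0 : ∀ i, dW i ≠ 0)
      (Φ : HA L e dV hdV dW hdW → ℝ), Continuous Φ → (∀ x, 0 < Φ x) →
      (∀ p x : HA L e dV hdV dW hdW, IsSiegelDelta L e dV hdV dW hdW p →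
        Φ (p * x) = modDelta L e dV hdV dW hdW p * Φ x) →
      ∃ τ₁ : ℝ, ∀ τ : ℝ, τ₁ ≤ τ →
        ∀ [MeasurableSpace (UnitaryGroup.adelic (Fp L) L (IsCMField.complexConj L) N (Matrix.diagonal dV))]
          [BorelSpace (UnitaryGroup.adelic (Fp L) L (IsCMField.complexConj L) N (Matrix.diagonal dV))]
          (ν : Measure (UnitaryGroup.adelic (Fp L) L (IsCMField.complexConj L) N (Matrix.diagonal dV)))
          [ν.IsHaarMeasure],
          Integrable (fun g => Φ (iotaLeft L e dV hdV dW hdW g) ^ τ) ν :=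
  -- ED. 8: TIED BY NAME to ★ p855285 `Theorems/K2LiuDoublingHeightDecay.lean` (K2Liu-p04 (g0); via ★ p855258 reduction + ★ #16a p855227 + ★ #16b p855222); statement block unchanged.
  Summit.HodgeConjecture.HodgeConjecture.Cruxes.HLiu418.K2LiuDoublingHeightDecay.doublingHeightDecay

/-- socket #16a (**PAID ★ p855227, TIED BY NAME ED. 7** — `Theorems/K2LiuDoublingHeightDecayPointwise.doublingHeightDecayPointwise`, K2Liu-p04 (g0), α = 1∕4 via the Plücker height of record; U5 ED. 5, RE-TYPED ED. 6 = `[NeZero N]` added after `{N n : ℕ}` — ref1 BOX #9 pt 1 ∕ LEAD RULING 21:51:22Z (A); organ (IV-c) «POINTWISE DOUBLING DECAY» of #16; size XL−; OWNER K2Liu-p04 lineage; typed from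
`K2/K2Liu-p04/g0/PLAN-16-DoublingHeightDecay.v1.K2Liu-p04-g0.md` §Organs (IV-c) «∃ C α > 0, ∀ g, Φ₀(ι(g,1)) ≤ C · ‖g‖^{-α}, ‖·‖ = ★ `adelicHeightGL`»
in the ∀Φ frame of #16 (equivalent to the one-height form by ★ p854882 `Theorems/K2LiuDoublingHeightComparison.exists_pos_forall_le_mul` + ★ p854827
organ (I)); deps ★ `K2Lit/DoublingEmbedding` (`iotaLeft`), ★ `GRConstruction.modDelta ∕ IsSiegelDelta`, ★ `Automorphic/AdelicGLnGlue.adelicHeightGL`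
(Borel–Jacquet height `‖g‖ = H_∞(g) ∏_v H_v(g)` of `(g, g⁻¹)`, `adelicHeightGL_inv`, ★ `AdelicHeightGLProofs.adelicHeightGL_pos_holds ∕ _mul_le_const`)) —
**POINTWISE DECAY OF A `P_Δ`-HEIGHT ALONG THE DOUBLING EMBEDDING.** For non-degenerate data (`dV i ≠ 0`, `dW 0 ≠ 0`; `W` of rank 1 — the U5 frame)
and every continuous height `Φ : H(𝔸) → ℝ_{>0}` of type `(P_Δ, modDelta)`, there are `C > 0` and `α > 0` with `Φ(ι(g,1)) ≤ C · ‖g‖^{-α}` for EVERY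
`g ∈ U(V)(𝔸)`, `‖g‖` the adelic height of `g` as an element of `GL_N(𝔸_L)`. Content ([GelbartPiatetskishapiroRallis1987, Part A §2: the `P`-part of
`ι(g,1)` under a Cartan decomposition `g = k₁ a k₂`], [Liu2021, Lem. B.10 (2) p. 102]): place by place the `Δ`-Plücker vector of `ι(g_v,1)` contains every
entry of `g_v⁻¹` and the constant `1`, and for UNITARY `g` the entries of `g⁻¹ = H⁻¹ ḡᵀ H` control those of `g` at the conjugate place, whence
`Φ(ι(g,1)) ≲ ∏_w max(1, |g|_w, |g⁻¹|_w)^{-α}` (K2Liu-p04's route (b2), `α = 1∕2` for the Plücker height; any `α > 0` is what #16 needs).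
DEGENERATE-CORNER PASS (ED. 6, CORRECTED): `N = 0` is now EXCLUDED by the binder `[NeZero N]` — ED. 5 was FALSE AS TYPED there
(K2Liu-ref1 BOX #9 pt 1, 21:51:08Z, refuted-misstated, paper witness: in the tree `‖1‖ = adelicHeightGL 0 L 1 = 0` is a JUNK VALUE
(★ `AdelicGLnGlue` :457∕:466; ★ `adelicHeightGL_pos` carries `[NeZero n]`), so with Mathlib `Real.zero_rpow` the conclusion read `Φ(1) ≤ C * 0 = 0`,
contradicting `Φ > 0`; the ED. 5 corner note silently assumed `‖1‖ = 1`); repaired per LEAD RULING 21:51:22Z (A) by the ONE binder matching ★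
`adelicHeightGL_pos`, every other byte unchanged (lesson (V6′): every `adelicHeightGL N`∕`archHeight` statement gets the `N = 0` junk pass); `dV i = 0` ∕ `dW 0 = 0` excluded by `_hdV0 ∕ _hdW0`; `V` isotropic:
statement stays TRUE (a growth estimate; no anisotropy used); junk: `‖g‖ ≥ 1` (★ `adelicHeightGL_pos`-type) so `‖g‖^{-α} ∈ (0, 1]`, no `0 ^ (-α)`
corner; `C, α` may depend on `Φ` and the data (quantified after them) ✓. No corner kill found.
Why it might fail: only through the CENTRE of `U(V)(𝔸)` (`g = z · 1`, `z z̄ = 1`, `z_w` large and `z_{w̄}` small at a split place): the bound needs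
`Φ(ι(z,1))` to DECAY there too — it does, since `ι(z,1)`'s `P_Δ`-part has `|det_Δ| = ∏_w max(|z|_w, |z|_w⁻¹)^{-N∕2}`-type size (both `g` and `g⁻¹`
enter the Plücker vector); a prover who finds a direction of `U(V)(𝔸)` where `Φ ∘ ι(·,1)` does not decay refutes the socket as typed (R8).
[cite: GelbartPiatetskishapiroRallis1987, Part A §2] [cite: Liu2021, Lem. B.10 (2) p. 102] [cite: BorelJacquet1979, §1.2 and §4.2] -/
theorem sig_K2LiuDoublingHeightDecayPointwise :
    ∀ (L : Type) [Field L] [NumberField L] [IsCMField L] {N n : ℕ} [NeZero N] (e : Fin N × Fin 1 ≃ Fin n)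
      (dV : Fin N → L) (hdV : ∀ i, IsCMField.complexConj L (dV i) = dV i) (_hdV0 : ∀ i, dV i ≠ 0)
      (dW : Fin 1 → L) (hdW : ∀ i, IsCMField.complexConj L (dW i) = dW i) (_hdW0 : ∀ i, dW i ≠ 0)
      (Φ : HA L e dV hdV dW hdW → ℝ), Continuous Φ → (∀ x, 0 < Φ x) →
      (∀ p x : HA L e dV hdV dW hdW, IsSiegelDelta L e dV hdV dW hdW p →
        Φ (p * x) = modDelta L e dV hdV dW hdW p * Φ x) →
      ∃ C α : ℝ, 0 < C ∧ 0 < α ∧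
        ∀ g : UnitaryGroup.adelic (Fp L) L (IsCMField.complexConj L) N (Matrix.diagonal dV),
          Φ (iotaLeft L e dV hdV dW hdW g) ≤ C * adelicHeightGL N L (g : GL (Fin N) (AdeleRing (𝓞 L) L)) ^ (-α) :=
  -- ED. 7: TIED BY NAME to ★ p855227 `Theorems/K2LiuDoublingHeightDecayPointwise.lean` (K2Liu-p04 (g0)); statement block ≡ ED. 6 bytes (sha16 9baf6756414068fe both sides).
  Summit.HodgeConjecture.HodgeConjecture.Cruxes.HLiu418.K2LiuDoublingHeightDecayPointwise.doublingHeightDecayPointwise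

/-- socket #16b (**PAID ★ p855222, TIED BY NAME ED. 7** — `Theorems/K2LiuAdelicNormIntegrable.adelicNormIntegrable`, K2Liu-p03 (g2) + p07 + p06 + p02, seven files in 41 min: Weil's criterion for every closed subgroup of `GL_N(𝔸_L)`; U5 ED. 5; organ (IV-d) «ADELIC NORM INTEGRABILITY ON `U(V)(𝔸)`» of #16; size XL (the analytic engine proper); OWNER K2Liu-p04
lineage; typed from `K2/K2Liu-p04/g0/PLAN-16-DoublingHeightDecay.v1.K2Liu-p04-g0.md` §Organs (IV-d) «∃ β₀, ∀ β > β₀, ∀ Haar ν,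
Integrable (fun g => adelicHeightGL N L (adelicVal g) ^ (-β)) ν» — in the U5 frame the `GL_N(𝔸_L)`-value of `g ∈ U(diag dV)(𝔸)` is the subgroup
coercion `(g : GL (Fin N) (AdeleRing (𝓞 L) L))`; deps ★ `Automorphic/AdelicGLnGlue.adelicHeightGL` (+ `GLn.localHeight ∕ archHeight`), ★
`Automorphic/UnitaryGroupSplitPlace`, ★ `GLnIntegerPointsVolume`, ★ `UnitaryGroupIntegralPointsReduction*`, ★ `ArchGroupGLCartan`, ★ `GLnRestrictedProductHaar` ∕
★ `UnitaryGroup.finAdelicEquiv` (K2Liu-p04's census; nearest ★ `AdelicHeightZetaConvergence`, `GLnSiegelHeightIntegrability` are a SUM over `ℙ^{n-1}(K)` ∕ a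
Siegel-set integral, not this)) — **WEIL'S ADELIC INTEGRABILITY CRITERION FOR `U(V)`.** For non-degenerate hermitian data (`dV i ≠ 0`) there is `β₀` such
that for every `β > β₀` and every Haar measure `ν` on `U(V)(𝔸) = U(diag dV)(𝔸)`, `g ↦ ‖g‖^{-β}` is `ν`-integrable. Content: locally
`vol{g ∈ U(V)(L⁺_v) : H_v(g) ≤ q_v^k} ≤ C q_v^{k d}` uniformly in `v` (split `v`: `GL_N` volumes; inert∕ramified: integral points; archimedean: Cartan
`KAK` + polynomial volume growth), `H_v ≡ 1` on the hyperspecial `K_v` at almost all `v`, and `∏_v (1 + O(q_v^{d-β})) < ∞` for `β > d + 1`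
([WeilBNT1967, Ch. VII §3]; [BorelJacquet1979, §1.2]; [MoeglinWaldspurger1995, I.2.2]). The centre `U(1)(𝔸)` is non-compact but `‖·‖` sees every place
separately (`∫_{𝕀_L, z z̄ = 1} ∏_w max(|z|_w,|z|_w⁻¹)^{-β} d^×z = ∏_v (1 + O(q_v^{-β})) < ∞`), so integrability holds on ALL of `U(V)(𝔸)` (no `G(𝔸)^1`
restriction needed). DEGENERATE-CORNER PASS: `N = 0` ⇒ trivial group, every function integrable ✓ (`β₀ = 0`); `dV i = 0` excluded by `_hdV0` (the
degenerate unitary group has a unipotent radical — likely still true, not claimed); `_hdV` kept for the frame (hermitian-ness of `diag dV`); junk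
`0 ^ (-β) = 0` never met (`‖g‖ ≥ 1`); the zero measure is not a Haar measure (`IsHaarMeasure` ⇒ positive on opens), harmless either way. No corner kill found.
Why it might fail: only if the tree's topology on `↥(UnitaryGroup.adelic …)` (subspace of `GL_N(𝔸_L)` with Mathlib's units topology) made `IsHaarMeasure`
pick a measure for which hyperspecial `K_v` have unbounded normalised volume — it does not (the units topology IS the restricted product topology, ★
`GLnRestrictedProductHaar`); the exponent `β₀` is free, so no sharp-constant risk (checklist (iv)).
[cite: WeilBNT1967, Ch. VII §3] [cite: BorelJacquet1979, §1.2] [cite: MoeglinWaldspurger1995, §I.2.2] [cite: Liu2021, Lem. B.10 (2) p. 102] -/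
theorem sig_K2LiuAdelicNormIntegrable :
    ∀ (L : Type) [Field L] [NumberField L] [IsCMField L] {N : ℕ}
      (dV : Fin N → L) (_hdV : ∀ i, IsCMField.complexConj L (dV i) = dV i) (_hdV0 : ∀ i, dV i ≠ 0),
      ∃ β₀ : ℝ, ∀ β : ℝ, β₀ < β →
        ∀ [MeasurableSpace (UnitaryGroup.adelic (Fp L) L (IsCMField.complexConj L) N (Matrix.diagonal dV))]
          [BorelSpace (UnitaryGroup.adelic (Fp L) L (IsCMField.complexConj L) N (Matrix.diagonal dV))]
          (ν : Measure (UnitaryGroup.adelic (Fp L) L (IsCMField.complexConj L) N (Matrix.diagonal dV)))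
          [ν.IsHaarMeasure],
          Integrable (fun g : UnitaryGroup.adelic (Fp L) L (IsCMField.complexConj L) N (Matrix.diagonal dV) =>
            adelicHeightGL N L (g : GL (Fin N) (AdeleRing (𝓞 L) L)) ^ (-β)) ν :=
  -- ED. 7: TIED BY NAME to ★ p855222 `Theorems/K2LiuAdelicNormIntegrable.lean` (K2Liu-p03 (g2); files 1–6 p855048 p855094 p855116 p855136 p855082∕p855121 p855222); statement bytes ≡ ED. 5∕6 :273.
  Summit.HodgeConjecture.HodgeConjecture.Cruxes.HLiu418.K2LiuAdelicNormIntegrable.adelicNormIntegrable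

end Summit.HodgeConjecture.HodgeConjecture.Cruxes.HLiu418.K2LiuCurveThetaSigsU5DoublingZeta
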